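import Literature.AnabelianGeometry.SemiGraphs.TemperedPiLevels
import Literature.AnabelianGeometry.SemiGraphs.TemperedPiFibreMap
import Literature.AnabelianGeometry.SemiGraphs.CoveringHomExt
import Literature.AnabelianGeometry.SemiGraphs.TemperedPiFull

/-!
# The fibre functor `B^temp(𝒢) ⥤ B^temp(π₁^temp(𝒢))` ([SemiAnbd] Prop. 3.6 (ii), p. 38)

For `𝒢` satisfying the hypotheses of Prop. 3.6: the functor `T ↦ T_{v₀}` with the action of
`π₁^temp(𝒢) = 𝒢.temperedPi h36` (`TemperedPiFibre.lean`, levels from `TemperedPiLevels.lean`),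
`φ ↦ φ_{v₀}` (`TemperedPiFibreMap.lean`), its faithfulness (`CoveringHomExt.lean`) and its
fullness (`TemperedPiFull.lean`).  Essential surjectivity — completing the equivalence
`B^temp(𝒢) ≅ B^temp(π₁^temp(𝒢))` of Prop. 3.6 (ii) — is proved separately.
-/

namespace Literature.AnabelianGeometry.SemiGraphs

namespace ProfiniteSemiGraph

open CategoryTheory

universe u

variable (𝒢 : ProfiniteSemiGraph.{u}) (h36 : 𝒢.Prop36Hypotheses)

/-- A level from which on the tower splits the component of `t ∈ T_{v₀}` (`T` tempered).
[cite: MochizukiSemiAnbd2006, Prop 3.6 p.38] -/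
noncomputable def levelOf (T : BTempCat 𝒢) (t : (T.obj.SV (𝒢.baseVertex h36)).obj.V) : ℕ :=
  (𝒢.exists_level_splits_component h36 T.obj T.property (Sum.inl ⟨_, t⟩)).choose

/-- Specification of `levelOf`. [cite: MochizukiSemiAnbd2006, Prop 3.6 p.38] -/
theorem levelOf_spec (T : BTempCat 𝒢) (t : (T.obj.SV (𝒢.baseVertex h36)).obj.V) (n : ℕ)
    (hn : 𝒢.levelOf h36 T t ≤ n) :
    ((𝒢.galoisLevelData h36).S n).Splits (T.obj.component (Sum.inl ⟨_, t⟩)) :=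
  (𝒢.exists_level_splits_component h36 T.obj T.property (Sum.inl ⟨_, t⟩)).choose_spec n hn

/-- **The fibre functor `B^temp(𝒢) ⥤ B^temp(π₁^temp(𝒢))`, `T ↦ T_{v₀}`.**
[cite: MochizukiSemiAnbd2006, Prop 3.6(ii) p.38] -/
noncomputable def temperedFibreFunctor : BTempCat 𝒢 ⥤ BTemp (𝒢.temperedPi h36) where
  obj T := (𝒢.galoisLevelData h36).fibreObj h36.isCountable T.obj (𝒢.levelOf h36 T)
    (𝒢.levelOf_spec h36 T)
  map {T T'} φ := (𝒢.galoisLevelData h36).fibreMap h36.isCountable φ.hom (𝒢.levelOf h36 T)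
    (𝒢.levelOf_spec h36 T) (𝒢.levelOf h36 T') (𝒢.levelOf_spec h36 T')
  map_id T := by
    apply ObjectProperty.hom_ext
    apply Action.Hom.ext
    rfl
  map_comp φ ψ := by
    apply ObjectProperty.hom_ext
    apply Action.Hom.ext
    rfl

/-- The underlying set of `Φ(T)` is the fibre `T_{v₀}`. [cite: MochizukiSemiAnbd2006, Prop 3.6(ii) p.38] -/
theorem temperedFibreFunctor_obj_V (T : BTempCat 𝒢) :
    ((𝒢.temperedFibreFunctor h36).obj T).obj.V = (T.obj.SV (𝒢.baseVertex h36)).obj.V := rfl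

/-- The underlying map of `Φ(φ)` is `φ_{v₀}`. [cite: MochizukiSemiAnbd2006, Prop 3.6(ii) p.38] -/
theorem temperedFibreFunctor_map_apply {T T' : BTempCat 𝒢} (φ : T ⟶ T')
    (t : (T.obj.SV (𝒢.baseVertex h36)).obj.V) :
    ((𝒢.temperedFibreFunctor h36).map φ).hom.hom t = (φ.hom.fV (𝒢.baseVertex h36)).hom.hom t := rfl

/-- **The fibre functor is faithful** (connectedness of `𝔾`). [cite: MochizukiSemiAnbd2006, Prop 3.6(ii) p.38] -/
theorem temperedFibreFunctor_faithful : (𝒢.temperedFibreFunctor h36).Faithful where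
  map_injective := by
    intro T T' φ ψ h
    have h1 : φ.hom.fV (𝒢.baseVertex h36) = ψ.hom.fV (𝒢.baseVertex h36) := by
      apply ObjectProperty.hom_ext
      apply Action.Hom.ext
      exact congrArg (fun m => m.hom.hom) h
    have h2 : φ.hom = ψ.hom := CovHom.ext_of_fV_eq φ.hom ψ.hom h36.isConnected _ h1
    exact InducedCategory.hom_ext h2

/-- **The fibre functor is full**: every `π₁^temp(𝒢)`-equivariant map of fibres comes from a
morphism of coverings. [cite: MochizukiSemiAnbd2006, Prop 3.6(ii) p.38] -/
theorem temperedFibreFunctor_full : (𝒢.temperedFibreFunctor h36).Full where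
  map_surjective {T T'} m := by
    refine ⟨ObjectProperty.homMk ((𝒢.galoisLevelData h36).fullHom h36.isCountable h36.isConnected
      T.obj T'.obj (𝒢.levelOf h36 T) (𝒢.levelOf_spec h36 T) (𝒢.levelOf h36 T')
      (𝒢.levelOf_spec h36 T') m), ?_⟩
    apply ObjectProperty.hom_ext
    apply Action.Hom.ext
    apply ConcreteCategory.hom_ext
    intro t
    exact (𝒢.galoisLevelData h36).fullHom_base h36.isCountable h36.isConnected T.obj T'.obj _ _ _ _ m t

end ProfiniteSemiGraph

end Literature.AnabelianGeometry.SemiGraphs
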